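import Literature.NumberTheory.QuadraticFields.ReducedForms
import Mathlib.Data.Int.Interval
import Mathlib.Data.Nat.Sqrt
import Mathlib.Algebra.Order.BigOperators.Group.Finset
import Mathlib.Analysis.Real.Sqrt
import HarnessLib

set_option linter.dupNamespace false -- `Summit.BirchSwinnertonDyer.BirchSwinnertonDyer.Theorems.…` (summit = sub, D-0017)
set_option autoImplicit false

/-!
# Crux `HeegnerTwistCouplingInSupply` (stmt-BirchSwinnertonDyer-21381), card `heavy-discriminant-sparsity` —
# §A the first moment of class numbers: `Σ_{−X ≤ D ≤ −1} h(D) ≤ X·√X`, and the tail `#{D : h(D) ≥ T} ≤ X√X/T`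

Route `BiquadraticEisensteinDescent` (cell `pub/bsd-wall`; width seat `bsd-wall-cm-bed-w4` g29; THEOREMS ONLY,
`--supports 21381`). First file of the unit «HEAVY-DISCRIMINANT SPARSITY + DENSITY DOOR» (crux idea
`Cruxes/HeegnerTwistCouplingInSupply/Ideas/heavy-discriminant-sparsity.md`, ideation seat 1 g37): the W-free, L-free
counting input of the card's research lemma `HeavySparse`. Vocabulary: `Literature/NumberTheory/QuadraticFields/ReducedForms.lean`
(`BinaryQuadraticForm.reducedForms D`, `BinaryQuadraticForm.classNumber D = h(D) = #reducedForms D`, Cox §2.A Thm. 2.13).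

Gauss (*Disquisitiones* art. 302) observed that the class numbers of negative determinants grow on average like
`√|D|`, i.e. `Σ_{|D| ≤ X} h(D) ≍ X^{3/2}` (asymptotics by Lipschitz and Mertens; Cohen, *A Course in Computational
Algebraic Number Theory*, §5.10). This file proves the elementary UPPER BOUND of that order, uniformly and with
constant `1`, by counting reduced triples: a reduced form `(a, b, c)` of discriminant `D ∈ [−X, −1]` has
`|b| ≤ a ≤ c`, hence `3a² ≤ 4ac − b² = −D ≤ X` and `12ac = 3b² + 3(−D) ≤ 4X`; so `1 ≤ a ≤ √X`, `−a ≤ b ≤ a`,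
`1 ≤ c ≤ X/(3a)`, and for each `a` there are at most `(2a+1)·⌊X/(3a)⌋ ≤ X` pairs `(b, c)`; distinct
discriminants have disjoint sets of reduced forms.

* `coeff_bounds_of_mem_reducedForms` — the coefficient box of a reduced form of discriminant `D ∈ [−X, −1]`;
* `pairwiseDisjoint_reducedForms` — reduced-form sets of distinct negative discriminants are disjoint;
* ★ `sum_classNumber_Icc_le_mul_sqrt` — `Σ_{D ∈ [−X,−1]} h(D) ≤ X·⌊√X⌋`;
* ★ `card_filter_le_classNumber_mul_le` — Markov: `#{D ∈ [−X,−1] : T ≤ h(D)}·T ≤ X·⌊√X⌋`, and the real-number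
  form `card_filter_le_classNumber_le_div` (`≤ X·√X / T`).

Consumer: `…HeegnerTwistCouplingInSupplyHeavySparse.lean` (class numbers `≥ 2^{k}·p` are rare in a window
`|D| ≤ A·p²`). NOT here: the asymptotic `Σ h(D) ~ (π/18ζ(3))·X^{3/2}`, lower bounds, fundamental discriminants
(the bound is over ALL `D ∈ [−X, −1]`; non-discriminants contribute `h(D) = 0`). HONEST FRAMING: an elementary
counting lemma; nothing about C⁺, the registered stubs, crux 21381 or BSD is proved by it.
[cite: Cox2013, §2.A eq. (2.7), (2.12), Thm. 2.13] [cite: Buell1989, Ch. 2]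
-/

noncomputable section

open Finset
open Literature.NumberTheory.QuadraticFields.BinaryQuadraticForm

namespace Summit.BirchSwinnertonDyer.BirchSwinnertonDyer.Theorems.HeavyDiscriminant

/-- **Coefficient box of a reduced form.** If `(a, b, c)` is a reduced primitive positive definite form of
discriminant `D` with `−X ≤ D < 0`, then `1 ≤ a ≤ ⌊√X⌋`, `−a ≤ b ≤ a` and `1 ≤ c ≤ X/(3a)` (integer division):
from `|b| ≤ a ≤ c` one gets `3a² ≤ 4ac − b² = −D ≤ X` and `12ac = 3b² − 3D ≤ 4X` (Cox (2.7), (2.12)).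
[cite: Cox2013, §2.A eq. (2.12)] -/
theorem coeff_bounds_of_mem_reducedForms {X : ℕ} {D : ℤ} (hD : D < 0) (hX : -(X : ℤ) ≤ D)
    {a b c : ℤ} (h : (a, b, c) ∈ reducedForms D) :
    1 ≤ a ∧ a ≤ Nat.sqrt X ∧ -a ≤ b ∧ b ≤ a ∧ 1 ≤ c ∧ c ≤ (X : ℤ) / (3 * a) := by
  rw [mem_reducedForms_iff hD] at h
  obtain ⟨hdisc, ha, -, hred⟩ := h
  obtain ⟨h1, h2, h3, -⟩ := hred
  simp only at ha h1 h2 h3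
  rw [discr_apply] at hdisc
  have hb2 : b ^ 2 ≤ a ^ 2 := by nlinarith
  have h4ac : 4 * (a * c) = b ^ 2 - D := by linarith
  have hac : a * a ≤ a * c := by nlinarith
  have h3a2 : 3 * (a * a) ≤ X := by nlinarith
  have haX : a ≤ Nat.sqrt X := by
    have han : ((a.toNat : ℕ) : ℤ) = a := Int.toNat_of_nonneg ha.le
    have hle : a.toNat ≤ Nat.sqrt X := by
      rw [Nat.le_sqrt]
      have h' : ((a.toNat * a.toNat : ℕ) : ℤ) ≤ (X : ℤ) := by
        push_cast
        rw [han]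
        nlinarith
      exact_mod_cast h'
    omega
  refine ⟨ha, haX, h1, h2, by omega, ?_⟩
  rw [Int.le_ediv_iff_mul_le (by omega)]
  nlinarith

/-- **Reduced-form sets of distinct negative discriminants are disjoint** (a form has one discriminant).
[folklore] -/
theorem pairwiseDisjoint_reducedForms (S : Finset ℤ) (hS : ∀ D ∈ S, D < 0) :
    (S : Set ℤ).PairwiseDisjoint reducedForms := by
  intro D hD D' hD' hne
  simp only [Function.onFun]
  rw [Finset.disjoint_left]
  intro Q hQ hQ'
  have h1 := ((mem_reducedForms_iff (hS D (mem_coe.mp hD))).mp hQ).1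
  have h2 := ((mem_reducedForms_iff (hS D' (mem_coe.mp hD'))).mp hQ').1
  exact hne (h1.symm.trans h2)

/-- **The sum of class numbers is the number of reduced forms of discriminant in the range**:
`Σ_{D ∈ [−X, −1]} h(D) = #⋃_{D} reducedForms D`. [folklore] -/
theorem sum_classNumber_Icc_eq_card_biUnion (X : ℕ) :
    ∑ D ∈ Icc (-(X : ℤ)) (-1), classNumber D = ((Icc (-(X : ℤ)) (-1)).biUnion reducedForms).card := by
  classical
  rw [card_biUnion (pairwiseDisjoint_reducedForms _ fun D hD ↦ by have := (mem_Icc.mp hD).2; omega)]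
  rfl

/-- ★ **First moment of class numbers (Gauss's order of magnitude, elementary upper bound):**
`Σ_{−X ≤ D ≤ −1} h(D) ≤ X·⌊√X⌋` for every `X : ℕ`, where `h(D)` is the number of reduced primitive positive
definite forms of discriminant `D` (Cox Thm. 2.13). Proof: the union of the `reducedForms D`, `D ∈ [−X,−1]`, is
disjoint and sits in the box `{(a,b,c) : 1 ≤ a ≤ ⌊√X⌋, |b| ≤ a, 1 ≤ c ≤ X/(3a)}` of size
`Σ_a (2a+1)⌊X/(3a)⌋ ≤ Σ_a X`. [folklore] -/
theorem sum_classNumber_Icc_le_mul_sqrt (X : ℕ) :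
    ∑ D ∈ Icc (-(X : ℤ)) (-1), classNumber D ≤ X * Nat.sqrt X := by
  classical
  rw [sum_classNumber_Icc_eq_card_biUnion]
  set U : Finset (ℤ × ℤ × ℤ) := (Icc 1 (Nat.sqrt X)).biUnion
    (fun n : ℕ ↦ ({(n : ℤ)} : Finset ℤ) ×ˢ (Icc (-(n : ℤ)) n ×ˢ Icc (1 : ℤ) ((X / (3 * n) : ℕ) : ℤ)))
    with hU
  have hsub : (Icc (-(X : ℤ)) (-1)).biUnion reducedForms ⊆ U := by
    intro Q hQ
    obtain ⟨a, b, c⟩ := Q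
    rw [mem_biUnion] at hQ
    obtain ⟨D, hDS, hQD⟩ := hQ
    obtain ⟨hXD, hD1⟩ := mem_Icc.mp hDS
    obtain ⟨ha1, haX, hb1, hb2, hc1, hc2⟩ := coeff_bounds_of_mem_reducedForms (by omega) hXD hQD
    rw [hU, mem_biUnion]
    refine ⟨a.toNat, mem_Icc.mpr ⟨by omega, by omega⟩, ?_⟩
    have han : ((a.toNat : ℕ) : ℤ) = a := Int.toNat_of_nonneg (by omega)
    simp only [mem_product, mem_singleton, mem_Icc]
    refine ⟨han.symm, ⟨by omega, by omega⟩, hc1, ?_⟩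
    rw [Int.natCast_div]
    push_cast
    rw [han]
    exact hc2
  have hUcard : U.card ≤ X * Nat.sqrt X := by
    calc U.card ≤ ∑ n ∈ Icc 1 (Nat.sqrt X),
          (({(n : ℤ)} : Finset ℤ) ×ˢ (Icc (-(n : ℤ)) n ×ˢ Icc (1 : ℤ) ((X / (3 * n) : ℕ) : ℤ))).card :=
          card_biUnion_le
      _ ≤ ∑ _n ∈ Icc 1 (Nat.sqrt X), X := by
          refine sum_le_sum fun n hn ↦ ?_
          obtain ⟨hn1, -⟩ := mem_Icc.mp hn
          rw [card_product, card_product, card_singleton, Int.card_Icc, Int.card_Icc, one_mul]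
          have h1 : ((n : ℤ) + 1 - -(n : ℤ)).toNat = 2 * n + 1 := by omega
          have h2 : (((X / (3 * n) : ℕ) : ℤ) + 1 - 1).toNat = X / (3 * n) := by
            generalize X / (3 * n) = m
            omega
          rw [h1, h2]
          calc (2 * n + 1) * (X / (3 * n)) ≤ (3 * n) * (X / (3 * n)) :=
                Nat.mul_le_mul_right _ (by omega)
            _ ≤ X := Nat.mul_div_le X (3 * n)
      _ = X * Nat.sqrt X := by
          rw [sum_const, Nat.card_Icc, smul_eq_mul, Nat.add_sub_cancel, mul_comm]
  exact (card_le_card hsub).trans hUcard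

/-- ★ **Tail of the class number distribution (Markov):** for all `X T : ℕ`,
`#{D ∈ [−X, −1] : T ≤ h(D)} · T ≤ X·⌊√X⌋`. [folklore] -/
theorem card_filter_le_classNumber_mul_le (X T : ℕ) :
    ((Icc (-(X : ℤ)) (-1)).filter (fun D ↦ T ≤ classNumber D)).card * T ≤ X * Nat.sqrt X := by
  calc ((Icc (-(X : ℤ)) (-1)).filter (fun D ↦ T ≤ classNumber D)).card * T
        = ∑ _D ∈ (Icc (-(X : ℤ)) (-1)).filter (fun D ↦ T ≤ classNumber D), T := by
          rw [sum_const, smul_eq_mul]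
    _ ≤ ∑ D ∈ (Icc (-(X : ℤ)) (-1)).filter (fun D ↦ T ≤ classNumber D), classNumber D :=
          sum_le_sum fun D hD ↦ (mem_filter.mp hD).2
    _ ≤ ∑ D ∈ Icc (-(X : ℤ)) (-1), classNumber D :=
          sum_le_sum_of_subset_of_nonneg (filter_subset _ _) fun _ _ _ ↦ Nat.zero_le _
    _ ≤ X * Nat.sqrt X := sum_classNumber_Icc_le_mul_sqrt X

/-- **Tail count, real form:** for `T ≥ 1`, `#{D ∈ [−X, −1] : T ≤ h(D)} ≤ X·√X / T` (with the real square
root; `⌊√X⌋ ≤ √X`). [folklore] -/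
theorem card_filter_le_classNumber_le_div (X : ℕ) {T : ℕ} (hT : 0 < T) :
    ((((Icc (-(X : ℤ)) (-1)).filter (fun D ↦ T ≤ classNumber D)).card : ℕ) : ℝ) ≤
      (X : ℝ) * Real.sqrt X / T := by
  have h := card_filter_le_classNumber_mul_le X T
  have hT' : (0 : ℝ) < T := by exact_mod_cast hT
  rw [le_div_iff₀ hT']
  have hs : ((Nat.sqrt X : ℕ) : ℝ) ≤ Real.sqrt X := by
    rw [Real.le_sqrt (by positivity) (by positivity)]
    exact_mod_cast Nat.sqrt_le' X
  calc ((((Icc (-(X : ℤ)) (-1)).filter (fun D ↦ T ≤ classNumber D)).card : ℕ) : ℝ) * T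
      ≤ (X : ℝ) * (Nat.sqrt X : ℕ) := by exact_mod_cast h
    _ ≤ (X : ℝ) * Real.sqrt X := by gcongr

end Summit.BirchSwinnertonDyer.BirchSwinnertonDyer.Theorems.HeavyDiscriminant

end
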